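import Summits.BirchSwinnertonDyer.BirchSwinnertonDyer.Theorems.SignedLowerHalvesKobayashiLowerHalfLargeImageTwistToLocus
import HarnessLib

/-!
# Route `SignedLowerHalves`, crux `KobayashiLowerHalfLargeImage` (item stmt-BirchSwinnertonDyer-19001):
# the registered stub's own hypotheses — OFF the Fouquet–Wan locus, (ram) ⟹ a quadratic twist ON it
# (cell `bsd-ssimc`, seat `bsd-ssimc-k3-c3` gen 3; a `--supports … --as helper` file, closes nothing).
# Companion of `…LargeImageTwistToLocus.lean` (p430776 + p432609).

PARTITION (cell bsd-ssimc): X7 (A7) × off-FW-locus pairs WITH a (ram) prime (pieces A ∪ T ∪ B ∪ C of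
MEMO-3 §T: 254 of the 277 window pairs; the complement D ∪ E, 23 pairs, has none) —
types-the-object-of; closes NONE. THEOREMS ONLY; no definition; nothing about any curve is asserted;
FW stays PRE; BSD is not proved by any of this.

Off the Fouquet–Wan locus (the negated locus hypothesis of the registered stub `stub_offFwLocus`,
verbatim) every `ρ̄`-ramified multiplicative prime `ℓ ≠ p` is SPLIT; so wherever the tree's predicate
`Rank1Residual.Ram W p` holds (Skinner–Urban's (ram): a prime `ℓ ≠ p` of multiplicative reduction with
`p ∤ ord_ℓ Δ_min`), the parity-free twist-to-locus theorem `exists_twist_on_fwLocus_of_split_ram'`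
applies: `exists_twist_on_fwLocus_of_offFwLocus_of_ram` (a THEOREM), and modulo the FW binder the
twist satisfies Kobayashi's main conjecture for both signs
(`exists_twist_kobayashiMainConjecture_of_thm451_OPEN_of_offFwLocus_of_ram`, CONDITIONAL). Reading
(MEMO-4 §F): on `stub_offFwLocus ∧ Ram` the missing input is twist DESCENT (not claimed); on
`stub_offFwLocus ∧ ¬Ram` (no `ρ̄`-ramified multiplicative prime at all) nothing is known or shaped.

References: [SkinnerUrban2014] Thm. 2 (ram); [FouquetWan2021] Thm 4.51 (PRE); [Kobayashi2003]
Thm. 7.4, Conjecture (p. 2); [SilvermanAEC2009] X.5 Cor. 5.4; cell memo k3-c3 MEMO-4.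
-/

set_option autoImplicit false
set_option linter.dupNamespace false

noncomputable section

open scoped Classical

open WeierstrassCurve Literature.NumberTheory.EllipticCurves
  Literature.NumberTheory.EllipticCurves.Rank1Residual
  Summit.BirchSwinnertonDyer.Rank1Residual.Supersingular

namespace Summit.BirchSwinnertonDyer.BirchSwinnertonDyer.Theorems

section OffLocusRam

variable (W : WeierstrassCurve ℚ) [W.IsElliptic] [W.IsGloballyMinimal]

/-- **`stub_offFwLocus` hypotheses + (ram) ⟹ a quadratic twist ON the Fouquet–Wan locus.** For `W`
globally minimal, `p` odd, `ClassX7 W p`, `¬CM`, `a_p = 0`, `ρ̄_{E,p}` onto, OFF the FW locus (the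
registered stub's negated-locus hypothesis verbatim) and with `Ram W p` (a prime `ℓ ≠ p` of
multiplicative reduction with `p ∤ ord_ℓ Δ_min`): that `ℓ` is split (else `W` would be on the locus),
so `exists_twist_on_fwLocus_of_split_ram'` gives a prime `q ∉ {2,p}` and a globally minimal model `W'`
of `W^{(q)}` that is an X7 pair at `p` with `a_p = 0`, `ρ̄` onto, no CM and satisfies the LOCUS
hypothesis of `stub_fwLocus`. A THEOREM; nothing about Kobayashi's conjecture is asserted.
[cite: SkinnerUrban2014, Thm. 2 (p. 3), second bullet] [cite: SilvermanAEC2009, X.5 Cor. 5.4] -/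
theorem exists_twist_on_fwLocus_of_offFwLocus_of_ram (p : ℕ) [Fact p.Prime] (hp : p ≠ 2)
    (hX : ClassX7 W p) (hcm : ¬ W.HasCM) (hap : W.frobeniusTrace p = 0) (hs : Surj W p)
    (hoff : ¬ (∃ ℓ : ℕ, ∃ _ : Fact ℓ.Prime, ℓ ≠ p ∧ W.HasMultiplicativeReductionAtPrime ℓ ∧
      ¬ W.HasSplitMultiplicativeReductionAtPrime ℓ ∧ ¬ p ∣ padicValInt ℓ W.minimalDiscriminantInt))
    (hram : Ram W p) :
    ∃ (q : ℕ) (_ : Fact q.Prime) (W' : WeierstrassCurve ℚ) (_ : W'.IsElliptic) (_ : W'.IsGloballyMinimal)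
      (C : VariableChange ℚ), q ≠ 2 ∧ q ≠ p ∧ C • W' = W.quadraticTwist ((q : ℤ) : ℚ) ∧
      ClassX7 W' p ∧ ¬ W'.HasCM ∧ W'.frobeniusTrace p = 0 ∧ Surj W' p ∧
      (∃ ℓ : ℕ, ∃ _ : Fact ℓ.Prime, ℓ ≠ p ∧ W'.HasMultiplicativeReductionAtPrime ℓ ∧
        ¬ W'.HasSplitMultiplicativeReductionAtPrime ℓ ∧ ¬ p ∣ padicValInt ℓ W'.minimalDiscriminantInt) := by
  obtain ⟨ℓ, hℓ, hℓp, hmult, hordℓ⟩ := hram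
  have hsplit : W.HasSplitMultiplicativeReductionAtPrime ℓ := by
    by_contra hns
    exact hoff ⟨ℓ, hℓ, hℓp, hmult, hns, hordℓ⟩
  obtain ⟨q, hq, W', hE', hM', C, hq2, hqp, hC, hX', hcm', hap', hs', hloc⟩ :=
    exists_twist_on_fwLocus_of_split_ram' W p hp hX hcm hap hs hℓp hmult hsplit hordℓ
  exact ⟨q, hq, W', hE', hM', C, hq2, hqp, hC, hX', hcm', hap', hs', ℓ, hℓ, hloc⟩

/-- **Modulo the Fouquet–Wan binder: `stub_offFwLocus` hypotheses + (ram) ⟹ Kobayashi's main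
conjecture for a quadratic twist, both signs.** CONDITIONAL; no descent to `W` is claimed; the 23
window pairs without a (ram) prime are untouched. [claim: FouquetWan2021, status: under-review]
[cite: Kobayashi2003, Thm. 7.4 (p. 13) and Conjecture (p. 2)] -/
theorem exists_twist_kobayashiMainConjecture_of_thm451_OPEN_of_offFwLocus_of_ram
    (hFW : FouquetWan2021_thm451_via_kobayashi74_OPEN) (p : ℕ) [Fact p.Prime] (hp : p ≠ 2)
    (hX : ClassX7 W p) (hcm : ¬ W.HasCM) (hap : W.frobeniusTrace p = 0) (hs : Surj W p)
    (hoff : ¬ (∃ ℓ : ℕ, ∃ _ : Fact ℓ.Prime, ℓ ≠ p ∧ W.HasMultiplicativeReductionAtPrime ℓ ∧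
      ¬ W.HasSplitMultiplicativeReductionAtPrime ℓ ∧ ¬ p ∣ padicValInt ℓ W.minimalDiscriminantInt))
    (hram : Ram W p) :
    ∃ (q : ℕ) (_ : Fact q.Prime) (W' : WeierstrassCurve ℚ) (_ : W'.IsElliptic) (_ : W'.IsGloballyMinimal)
      (C : VariableChange ℚ), q ≠ 2 ∧ q ≠ p ∧ C • W' = W.quadraticTwist ((q : ℤ) : ℚ) ∧
      ∀ ε : ℤˣ, KobayashiMainConjecture W' p ε := by
  obtain ⟨q, hq, W', hE', hM', C, hq2, hqp, hC, hX', -, hap', hs', hloc⟩ :=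
    exists_twist_on_fwLocus_of_offFwLocus_of_ram W p hp hX hcm hap hs hoff hram
  exact ⟨q, hq, W', hE', hM', C, hq2, hqp, hC,
    X7.kobayashiMainConjecture_of_thm451_OPEN_of_surj W' p hFW hp hX' hap' hs' hloc⟩

end OffLocusRam

end Summit.BirchSwinnertonDyer.BirchSwinnertonDyer.Theorems

end
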